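import Summits.Ventures.Crystal3D.Theorems.StickyWulffConstantTextureLiminfTexShadowEdgeOnFluxLayerRows
import Summits.Ventures.Crystal3D.Theorems.StickyWulffConstantTextureLiminfTexShadowEdgeOnRepCover
import Summits.Ventures.Crystal3D.Theorems.StickyWulffConstantGenericWallFloorTailSeparationOneSided
import HarnessLib

/-!
# TexShadow row (e) / EDGE-ON bump C: the SEP and READ cells are JOINT / FULL READS of the relative twin word; UNREAD launch pairs certify;
# the zone split of the SEP / READ stubs by the LAYER ROWS machine
# (lane T, crux `TextureLiminfV5`, stmt-Ventures-23912; cf-p1 RULING (ccxvi)(A)(2) 2026-08-29T13:07:25Z; 19480-p1 g17 memo SEP-CELLS-g17.md)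

HONEST FRAMING. Venture `Summits/Ventures/Crystal3D` (cell `crystal3d-full`), route `route-Ventures-StickyWulffConstant`, helper
`--supports` the law-v5 crux `TextureLiminfV5` (stmt-Ventures-23912), registered line `TexShadow` v8.12, stubs `stub_edgeOnSep` /
`stub_edgeOnRead` (bump C).  PURE GLUE over lane G's word calculus already in the tree (`exists_shallow_witness`,
`chainFrames_separated_of_unread`, `chainFrames_apart_of_unread`) and the two-sided certificate vocabulary; NO certificate is asserted,
NO cell is closed here; rung F-C1 not moved; the crux is not claimed.

THE POINT (memo SEP-CELLS-g17.md §1–§3).  Write `P₁ = upFrame L₁ e₃`, `P₂ = upFrame L₂ (−e₃)` for the up-presentations of a presentation pair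
and suppose the two plates are twin-chain related, `P₂·Λ₀ = (wordFrame P₁ κ)·Λ₀` for a reduced admissible model word `κ` (inside the faulted
residual core this is automatic: `InResidualClass` contains `RayAlignedAt`).  Then
* **SEP is a JOINT READ** (`exists_jointRead_of_coAxFrames`): if a chain frame of the launch `(z₁, v₁)` of plate 1 is Barlow-coaxial
  (`CoAxFrames`) with a chain frame of the launch `(z₂, v₂)` of plate 2, then there are coaxial chain frames at ray DEPTHS `d₁`, `d₂` with
  `|κ| − 1 ≤ d₁ + d₂ ≤ |κ|` — the two forced rays retrace `κ` from both ends up to one letter (19480-p1 g15 STEEP-PLATE §4a, now by name);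
* **READ is a FULL READ** (`exists_deepRead_of_read`): if a chain frame of `(z₁, v₁)` carries `L₂·Λ₀` or its basal twin, then for every
  `d ≤ |κ| − 2` some forced ray of the launch reads the last `d + 1` letters of `κ` (its depth-`(d+1)` ray word is `κ`'s end);
* **UNREAD LAUNCH PAIRS CERTIFY** (`twoSidedSteerWide_of_unread`, `repCertified_of_unread`): an admissible launch pair meeting the two-sided
  flux clause whose plate-1 rays read at most `d` letters of `κ`'s end and whose plate-2 rays read at most `c` letters of the end of every
  inverse word `κ.reverse.map S`, with `d + c + 2 ≤ |κ|`, satisfies ALL THREE pair clauses (i), (ii), (iii)_z of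
  `BarlowTwoSidedCertifiedSteerWide` — so it certifies the pair over the represented two-sided menu.  This is the kernel form of the
  «two-launch pigeonhole» tail device: two admissible launches of a plate whose depth-`(d+1)` ray-word sets are disjoint cannot both read
  a given word, so every word of length `≥ 2d + 2` is certified wherever both plates have such a pair (memo §3: at prefix depth 8 this holds
  at every view of the zone where both plates are tilted `≤ 77.08°`, scan `calc/tail2`).
* **ZONE SPLIT** (`coreOn_zoneR_of_layerRowsMachines`, `coreOn_of_zones`): the LAYER ROWS machines (`LayerRowsMachine Apart C`, plate 1;
  `LayerRowsMachineTop Apart' C'`, plate 2 — R1 of 19480-p2) give the faulted residual core on ANY class `X` restricted to the zone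
  «some plate within `arcsin √(1/20)` of edge-on and row-apart», with no flux or separation hypothesis; so each of `stub_edgeOnSep`,
  `stub_edgeOnRead` is the zone-R part (derived from the machines) plus a registered remainder on the complement zone.
WHAT THIS IS NOT: no certificate, no measure statement, no cell is closed; the per-view datum «two prefix-disjoint admissible launches» is an
engine statement (memo §3) and is NOT asserted; F-C1 not moved.
-/

noncomputable section

open scoped BigOperators InnerProductSpace ENNReal
open MeasureTheory Filter

namespace Summit.Ventures.Crystal3D.Cruxes.TextureLiminf.TexShadow

open Summit.Ventures.Crystal3D Summit.Ventures.Crystal3D.Theorems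
open Literature.MathematicalPhysics.StatisticalMechanics (IsHaggSeq fccStacking barlowStacking basalMirror constHagg isHaggSeq_const)

/-! ## Presentations: the up-frame is the frame or its basal flip; the passive plate's two lattices are Barlow-coaxial with either -/

/-- `upFrame L e` is `L` or `basalMirror ≫ L`. -/
theorem upFrame_eq_or (L : E3 ≃ₗᵢ[ℝ] E3) (e : E3) : upFrame L e = L ∨ upFrame L e = basalMirror.trans L := by
  unfold upFrame
  split_ifs with h
  · exact Or.inl rfl
  · exact Or.inr rfl

/-- A lattice `L '' (Barlow stacking of a Hägg word)` lies in a Barlow stacking presented by `L` (translation `0`). -/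
theorem image_subset_translate_barlow (L : E3 ≃ₗᵢ[ℝ] E3) (σ : ℤ → ℤ) :
    L '' barlowStacking 1 (Real.sqrt (2 / 3)) σ ⊆ (fun p => L p + 0) '' barlowStacking 1 (Real.sqrt (2 / 3)) σ := by
  rintro _ ⟨p, hp, rfl⟩
  exact ⟨p, hp, by simp⟩

/-- **A frame carrying `L·Λ₀` or its basal twin is Barlow-coaxial with `L` and with `basalMirror ≫ L`** (all four lattices are Barlow
stackings in the layer frame `L`: words `+1` and `−1`). -/
theorem coAxFrames_of_image_eq_of_pres {F P L : E3 ≃ₗᵢ[ℝ] E3}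
    (hF : F '' fccStacking 1 (Real.sqrt (2 / 3)) = L '' fccStacking 1 (Real.sqrt (2 / 3)) ∨
      F '' fccStacking 1 (Real.sqrt (2 / 3)) = (twinFrame L (L e₃)) '' fccStacking 1 (Real.sqrt (2 / 3)))
    (hP : P = L ∨ P = basalMirror.trans L) : CoAxFrames F P := by
  have hneg : IsHaggSeq (fun _ : ℤ => (-1 : ℤ)) := fun _ => Or.inr rfl
  -- the lattice of `F` as an `L`-presented Barlow stacking
  have hF' : ∃ σ : ℤ → ℤ, IsHaggSeq σ ∧
      F '' fccStacking 1 (Real.sqrt (2 / 3)) ⊆ (fun p => L p + 0) '' barlowStacking 1 (Real.sqrt (2 / 3)) σ := by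
    rcases hF with h | h
    · exact ⟨constHagg, isHaggSeq_const, by rw [h]; exact image_subset_translate_barlow L constHagg⟩
    · exact ⟨fun _ => -1, hneg, by rw [h, image_twinFrame_axis]; exact image_subset_translate_barlow L _⟩
  -- the lattice of `P` likewise
  have hP' : ∃ σ' : ℤ → ℤ, IsHaggSeq σ' ∧
      P '' fccStacking 1 (Real.sqrt (2 / 3)) ⊆ (fun p => L p + 0) '' barlowStacking 1 (Real.sqrt (2 / 3)) σ' := by
    rcases hP with rfl | rfl
    · exact ⟨constHagg, isHaggSeq_const, image_subset_translate_barlow P constHagg⟩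
    · exact ⟨fun _ => -1, hneg, by rw [image_basalMirror_trans]; exact image_subset_translate_barlow L _⟩
  obtain ⟨σ, hσ, hFσ⟩ := hF'
  obtain ⟨σ', hσ', hPσ⟩ := hP'
  exact ⟨L, 0, 0, σ, σ', hσ, hσ', hFσ, hPσ⟩

/-! ## SEP cells are joint reads, READ cells are full reads (characterisation by name) -/

/-- **SEP IS A JOINT READ.**  `P₂·Λ₀ = (wordFrame P₁ κ)·Λ₀` with `κ` reduced admissible; if SOME chain frame of the launch `(z₁, v₁)` of `P₁` is
Barlow-coaxial with SOME chain frame of the launch `(z₂, v₂)` of `P₂`, then chain frames at ray DEPTHS `d₁`, `d₂` (`0` = the base frame,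
`k + 1` = level `k` of a forced ray) with `d₁ + d₂ ≤ |κ| ≤ d₁ + d₂ + 1` are Barlow-coaxial: the two forced rays jointly retrace `κ` up to one
letter (lane G's `exists_shallow_witness`, in lane T's `CoAxFrames` vocabulary). -/
theorem exists_jointRead_of_coAxFrames {z₁ z₂ : E3} {P₁ P₂ G₁ G₂ : E3 ≃ₗᵢ[ℝ] E3} {v₁ v₂ : E3} {κ : List E3}
    (hκl : ∀ μ ∈ κ, ‖μ‖ = 1 ∧
      ∀ w ∈ fccSlots, ⟪w, μ⟫_ℝ = 0 ∨ ⟪w, μ⟫_ℝ = Real.sqrt (2 / 3) ∨ ⟪w, μ⟫_ℝ = -Real.sqrt (2 / 3))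
    (hκc : List.IsChain (fun μ μ' => ⟪μ, μ'⟫_ℝ = 1 / 3 ∨ ⟪μ, μ'⟫_ℝ = -1 / 3) κ)
    (hP₂ : P₂ '' fccStacking 1 (Real.sqrt (2 / 3)) = (wordFrame P₁ κ) '' fccStacking 1 (Real.sqrt (2 / 3)))
    (hG₁ : G₁ ∈ chainFrames z₁ P₁ v₁) (hG₂ : G₂ ∈ chainFrames z₂ P₂ v₂) (hco : CoAxFrames G₁ G₂) :
    ∃ d₁ d₂ : ℕ, d₁ + d₂ ≤ κ.length ∧ κ.length ≤ d₁ + d₂ + 1 ∧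
      ∃ H₁ ∈ chainFrames z₁ P₁ v₁, ∃ H₂ ∈ chainFrames z₂ P₂ v₂,
        (d₁ = 0 ∧ H₁ = P₁ ∨ ∃ n₁ : E3, ‖n₁‖ = 1 ∧
          (∀ w ∈ fccSlots, ⟪P₁ w, n₁⟫_ℝ = 0 ∨ ⟪P₁ w, n₁⟫_ℝ = Real.sqrt (2 / 3) ∨ ⟪P₁ w, n₁⟫_ℝ = -Real.sqrt (2 / 3)) ∧
          ⟪P₁ v₁, n₁⟫_ℝ = Real.sqrt (2 / 3) ∧ 0 < d₁ ∧ H₁ = (forcedTop z₁ ⟨P₁, v₁, 0⟩ n₁ (d₁ - 1)).frame) ∧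
        (d₂ = 0 ∧ H₂ = P₂ ∨ ∃ n₂ : E3, ‖n₂‖ = 1 ∧
          (∀ w ∈ fccSlots, ⟪P₂ w, n₂⟫_ℝ = 0 ∨ ⟪P₂ w, n₂⟫_ℝ = Real.sqrt (2 / 3) ∨ ⟪P₂ w, n₂⟫_ℝ = -Real.sqrt (2 / 3)) ∧
          ⟪P₂ v₂, n₂⟫_ℝ = Real.sqrt (2 / 3) ∧ 0 < d₂ ∧ H₂ = (forcedTop z₂ ⟨P₂, v₂, 0⟩ n₂ (d₂ - 1)).frame) ∧
        CoAxFrames H₁ H₂ :=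
  exists_shallow_witness hκl hκc hP₂ hG₁ hG₂ hco

/-- **READ IS A FULL READ.**  `A₂·Λ₀ = (wordFrame P₁ κ)·Λ₀` with `κ` reduced admissible, `d + 2 ≤ |κ|`; if some chain frame of the launch
`(z₁, v₁)` of `P₁` carries `A₂·Λ₀` or its basal twin `(twinFrame A₂ (A₂ e₃))·Λ₀`, then some forced ray of the launch READS the last `d + 1`
letters of `κ` (its depth-`(d+1)` ray word has `κ`'s last `d + 1` mirrors) — for every such `d`, i.e. the read is (all but one letter) full.
Contrapositive of lane G's `chainFrames_apart_of_unread`. -/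
theorem exists_deepRead_of_read {z₁ : E3} {P₁ A₂ : E3 ≃ₗᵢ[ℝ] E3} {v₁ : E3} {κ : List E3}
    (hκl : ∀ μ ∈ κ, ‖μ‖ = 1 ∧
      ∀ w ∈ fccSlots, ⟪w, μ⟫_ℝ = 0 ∨ ⟪w, μ⟫_ℝ = Real.sqrt (2 / 3) ∨ ⟪w, μ⟫_ℝ = -Real.sqrt (2 / 3))
    (hκc : List.IsChain (fun μ μ' => ⟪μ, μ'⟫_ℝ = 1 / 3 ∨ ⟪μ, μ'⟫_ℝ = -1 / 3) κ)
    (hA₂ : A₂ '' fccStacking 1 (Real.sqrt (2 / 3)) = (wordFrame P₁ κ) '' fccStacking 1 (Real.sqrt (2 / 3)))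
    {d : ℕ} (hd : d + 2 ≤ κ.length)
    (hread : ∃ F ∈ chainFrames z₁ P₁ v₁,
      F '' fccStacking 1 (Real.sqrt (2 / 3)) = A₂ '' fccStacking 1 (Real.sqrt (2 / 3)) ∨
      F '' fccStacking 1 (Real.sqrt (2 / 3)) = (twinFrame A₂ (A₂ e₃)) '' fccStacking 1 (Real.sqrt (2 / 3))) :
    ∃ n₁ : E3, ‖n₁‖ = 1 ∧
      (∀ w ∈ fccSlots, ⟪P₁ w, n₁⟫_ℝ = 0 ∨ ⟪P₁ w, n₁⟫_ℝ = Real.sqrt (2 / 3) ∨ ⟪P₁ w, n₁⟫_ℝ = -Real.sqrt (2 / 3)) ∧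
      ⟪P₁ v₁, n₁⟫_ℝ = Real.sqrt (2 / 3) ∧
      (rayWord z₁ ⟨P₁, v₁, 0⟩ n₁ (d + 1)).map (fun μ => (ℝ ∙ μ)ᗮ.reflection) =
        (κ.drop (κ.length - (d + 1))).map (fun μ => (ℝ ∙ μ)ᗮ.reflection) := by
  by_contra h
  push Not at h
  obtain ⟨F, hF, hor⟩ := hread
  have hap := chainFrames_apart_of_unread hκl hκc hA₂ hd (fun n₁ hn₁ hm₁ hp₁ => h n₁ hn₁ hm₁ hp₁) F hF
  rcases hor with h₁ | h₁
  · exact hap.1 h₁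
  · exact hap.2 h₁

/-! ## The tail device: UNREAD launch pairs satisfy all three pair clauses -/

/-- **UNREAD LAUNCH PAIRS CERTIFY TWO-SIDEDLY.**  Presented plates `(L₁, σ₁)`, `(L₂, σ₂)` with up-presentations `P₁ = upFrame L₁ e₃`,
`P₂ = upFrame L₂ (−e₃)`, twin-chain related by the reduced admissible word `κ` (`P₂·Λ₀ = (wordFrame P₁ κ)·Λ₀`); an admissible launch pair
`(z₁, v₁)`, `(z₂, v₂)` at chord `1/3` meeting the two-sided flux clause at charge `c₀`; plate 1's forced rays read at most `d` letters of `κ`'s end,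
plate 2's forced rays read at most `c` letters of the end of every inverse word `κ.reverse.map S`, and `d + c + 2 ≤ |κ|`.  Then
`BarlowTwoSidedCertifiedSteerWide c₀ σ₁ σ₂ L₁ L₂ z₁ v₁ z₂ v₂`: clause (iii)_z is `chainFrames_separated_of_unread`; clauses (i)/(ii) follow
because the base frames are chain frames and the passive plate's two lattices are Barlow-coaxial with its up-presentation
(`coAxFrames_of_image_eq_of_pres`). -/
theorem twoSidedSteerWide_of_unread {c₀ : ℝ} {σ₁ σ₂ : ℤ → ℤ} {L₁ L₂ : E3 ≃ₗᵢ[ℝ] E3} {z₁ v₁ z₂ v₂ : E3}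
    (h₁ : SteerLaunchAt (1 / 3) L₁ σ₁ e₃ z₁ v₁) (h₂ : SteerLaunchAt (1 / 3) L₂ σ₂ (-e₃) z₂ v₂)
    (hflux : ∀ i j : ℤ, Real.sqrt 2 * c₀ ≤
      steerRise (upFrame L₁ e₃) (upWord L₁ σ₁ e₃) e₃ z₁ v₁ i + steerRise (upFrame L₂ (-e₃)) (upWord L₂ σ₂ (-e₃)) (-e₃) z₂ v₂ j)
    {κ : List E3}
    (hκl : ∀ μ ∈ κ, ‖μ‖ = 1 ∧
      ∀ w ∈ fccSlots, ⟪w, μ⟫_ℝ = 0 ∨ ⟪w, μ⟫_ℝ = Real.sqrt (2 / 3) ∨ ⟪w, μ⟫_ℝ = -Real.sqrt (2 / 3))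
    (hκc : List.IsChain (fun μ μ' => ⟪μ, μ'⟫_ℝ = 1 / 3 ∨ ⟪μ, μ'⟫_ℝ = -1 / 3) κ)
    (hκ : (upFrame L₂ (-e₃)) '' fccStacking 1 (Real.sqrt (2 / 3)) =
      (wordFrame (upFrame L₁ e₃) κ) '' fccStacking 1 (Real.sqrt (2 / 3)))
    {d c : ℕ} (hdc : d + c + 2 ≤ κ.length)
    (hread₁ : ∀ n₁ : E3, ‖n₁‖ = 1 →
      (∀ w ∈ fccSlots, ⟪upFrame L₁ e₃ w, n₁⟫_ℝ = 0 ∨ ⟪upFrame L₁ e₃ w, n₁⟫_ℝ = Real.sqrt (2 / 3) ∨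
        ⟪upFrame L₁ e₃ w, n₁⟫_ℝ = -Real.sqrt (2 / 3)) →
      ⟪upFrame L₁ e₃ v₁, n₁⟫_ℝ = Real.sqrt (2 / 3) →
      (rayWord z₁ ⟨upFrame L₁ e₃, v₁, 0⟩ n₁ (d + 1)).map (fun μ => (ℝ ∙ μ)ᗮ.reflection) ≠
        (κ.drop (κ.length - (d + 1))).map (fun μ => (ℝ ∙ μ)ᗮ.reflection))
    (hread₂ : ∀ (S : E3 ≃ₗᵢ[ℝ] E3),
      S '' fccStacking 1 (Real.sqrt (2 / 3)) = fccStacking 1 (Real.sqrt (2 / 3)) →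
      (upFrame L₁ e₃) '' fccStacking 1 (Real.sqrt (2 / 3)) =
        (wordFrame (upFrame L₂ (-e₃)) (κ.reverse.map S)) '' fccStacking 1 (Real.sqrt (2 / 3)) →
      ∀ n₂ : E3, ‖n₂‖ = 1 →
        (∀ w ∈ fccSlots, ⟪upFrame L₂ (-e₃) w, n₂⟫_ℝ = 0 ∨ ⟪upFrame L₂ (-e₃) w, n₂⟫_ℝ = Real.sqrt (2 / 3) ∨
          ⟪upFrame L₂ (-e₃) w, n₂⟫_ℝ = -Real.sqrt (2 / 3)) →
        ⟪upFrame L₂ (-e₃) v₂, n₂⟫_ℝ = Real.sqrt (2 / 3) →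
        (rayWord z₂ ⟨upFrame L₂ (-e₃), v₂, 0⟩ n₂ (c + 1)).map (fun μ => (ℝ ∙ μ)ᗮ.reflection) ≠
          ((κ.reverse.map S).drop (κ.length - (c + 1))).map (fun μ => (ℝ ∙ μ)ᗮ.reflection)) :
    BarlowTwoSidedCertifiedSteerWide c₀ σ₁ σ₂ L₁ L₂ z₁ v₁ z₂ v₂ := by
  -- no chain frame of plate 1's launch is Barlow-coaxial with a chain frame of plate 2's launch
  have hsep : ∀ F₁ ∈ chainFrames z₁ (upFrame L₁ e₃) v₁, ∀ F₂ ∈ chainFrames z₂ (upFrame L₂ (-e₃)) v₂, ¬ CoAxFrames F₁ F₂ :=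
    fun F₁ hF₁ F₂ hF₂ hco => chainFrames_separated_of_unread hκl hκc hκ hdc hread₁ hread₂ F₁ hF₁ F₂ hF₂ hco
  refine twoSidedSteerWide_of_launches h₁ h₂ hflux ?_ ?_ hsep
  · -- (i): a chain frame of plate 1 carrying `L₂·Λ₀` or its basal twin would be coaxial with the base frame `P₂`
    intro F hF
    exact ⟨fun hEq => hsep F hF _ (self_mem_chainFrames z₂ _ v₂) (coAxFrames_of_image_eq_of_pres (Or.inl hEq) (upFrame_eq_or L₂ (-e₃))),
      fun hEq => hsep F hF _ (self_mem_chainFrames z₂ _ v₂) (coAxFrames_of_image_eq_of_pres (Or.inr hEq) (upFrame_eq_or L₂ (-e₃)))⟩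
  · -- (ii): symmetrically, against the base frame `P₁`
    intro F hF
    exact ⟨fun hEq => hsep _ (self_mem_chainFrames z₁ _ v₁) F hF
        (CoAxFrames.symm (coAxFrames_of_image_eq_of_pres (Or.inl hEq) (upFrame_eq_or L₁ e₃))),
      fun hEq => hsep _ (self_mem_chainFrames z₁ _ v₁) F hF
        (CoAxFrames.symm (coAxFrames_of_image_eq_of_pres (Or.inr hEq) (upFrame_eq_or L₁ e₃)))⟩

/-- **The represented-menu form**: an unread admissible flux-feasible launch pair in ANY presentation pair `(F₁, τ₁)`, `(F₂, τ₂)` of the two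
plates certifies the pair over the represented two-sided wide-steered menu (`BarlowMenuSteer2WideRepCertified`). -/
theorem repCertified_of_unread {c₀ : ℝ} {σ₁ σ₂ τ₁ τ₂ : ℤ → ℤ} {L₁ L₂ F₁ F₂ : E3 ≃ₗᵢ[ℝ] E3} {z₁ v₁ z₂ v₂ : E3}
    (hr₁ : IsRep σ₁ L₁ τ₁ F₁) (hr₂ : IsRep σ₂ L₂ τ₂ F₂)
    (h₁ : SteerLaunchAt (1 / 3) F₁ τ₁ e₃ z₁ v₁) (h₂ : SteerLaunchAt (1 / 3) F₂ τ₂ (-e₃) z₂ v₂)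
    (hflux : ∀ i j : ℤ, Real.sqrt 2 * c₀ ≤
      steerRise (upFrame F₁ e₃) (upWord F₁ τ₁ e₃) e₃ z₁ v₁ i + steerRise (upFrame F₂ (-e₃)) (upWord F₂ τ₂ (-e₃)) (-e₃) z₂ v₂ j)
    {κ : List E3}
    (hκl : ∀ μ ∈ κ, ‖μ‖ = 1 ∧
      ∀ w ∈ fccSlots, ⟪w, μ⟫_ℝ = 0 ∨ ⟪w, μ⟫_ℝ = Real.sqrt (2 / 3) ∨ ⟪w, μ⟫_ℝ = -Real.sqrt (2 / 3))
    (hκc : List.IsChain (fun μ μ' => ⟪μ, μ'⟫_ℝ = 1 / 3 ∨ ⟪μ, μ'⟫_ℝ = -1 / 3) κ)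
    (hκ : (upFrame F₂ (-e₃)) '' fccStacking 1 (Real.sqrt (2 / 3)) =
      (wordFrame (upFrame F₁ e₃) κ) '' fccStacking 1 (Real.sqrt (2 / 3)))
    {d c : ℕ} (hdc : d + c + 2 ≤ κ.length)
    (hread₁ : ∀ n₁ : E3, ‖n₁‖ = 1 →
      (∀ w ∈ fccSlots, ⟪upFrame F₁ e₃ w, n₁⟫_ℝ = 0 ∨ ⟪upFrame F₁ e₃ w, n₁⟫_ℝ = Real.sqrt (2 / 3) ∨
        ⟪upFrame F₁ e₃ w, n₁⟫_ℝ = -Real.sqrt (2 / 3)) →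
      ⟪upFrame F₁ e₃ v₁, n₁⟫_ℝ = Real.sqrt (2 / 3) →
      (rayWord z₁ ⟨upFrame F₁ e₃, v₁, 0⟩ n₁ (d + 1)).map (fun μ => (ℝ ∙ μ)ᗮ.reflection) ≠
        (κ.drop (κ.length - (d + 1))).map (fun μ => (ℝ ∙ μ)ᗮ.reflection))
    (hread₂ : ∀ (S : E3 ≃ₗᵢ[ℝ] E3),
      S '' fccStacking 1 (Real.sqrt (2 / 3)) = fccStacking 1 (Real.sqrt (2 / 3)) →
      (upFrame F₁ e₃) '' fccStacking 1 (Real.sqrt (2 / 3)) =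
        (wordFrame (upFrame F₂ (-e₃)) (κ.reverse.map S)) '' fccStacking 1 (Real.sqrt (2 / 3)) →
      ∀ n₂ : E3, ‖n₂‖ = 1 →
        (∀ w ∈ fccSlots, ⟪upFrame F₂ (-e₃) w, n₂⟫_ℝ = 0 ∨ ⟪upFrame F₂ (-e₃) w, n₂⟫_ℝ = Real.sqrt (2 / 3) ∨
          ⟪upFrame F₂ (-e₃) w, n₂⟫_ℝ = -Real.sqrt (2 / 3)) →
        ⟪upFrame F₂ (-e₃) v₂, n₂⟫_ℝ = Real.sqrt (2 / 3) →
        (rayWord z₂ ⟨upFrame F₂ (-e₃), v₂, 0⟩ n₂ (c + 1)).map (fun μ => (ℝ ∙ μ)ᗮ.reflection) ≠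
          ((κ.reverse.map S).drop (κ.length - (c + 1))).map (fun μ => (ℝ ∙ μ)ᗮ.reflection)) :
    BarlowMenuSteer2WideRepCertified c₀ σ₁ σ₂ L₁ L₂ :=
  repCertified_of_isRep hr₁ hr₂ (Or.inr ⟨z₁, v₁, z₂, v₂, twoSidedSteerWide_of_unread h₁ h₂ hflux hκl hκc hκ hdc hread₁ hread₂⟩)

/-! ## The zone split of the SEP / READ stubs by the LAYER ROWS machines -/

/-- **Zone R, plate 1**: the LAYER ROWS machine of plate 1 gives the faulted residual core on ANY class `X` restricted to
«plate 1 within `arcsin √(1/20)` of edge-on and `Apart`» (no flux, separation or read hypothesis on `X`). -/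
theorem coreOn_zoneR₁_of_layerRowsMachine (X : (ℤ → ℤ) → (ℤ → ℤ) → (E3 ≃ₗᵢ[ℝ] E3) → (E3 ≃ₗᵢ[ℝ] E3) → Prop)
    {Apart : (ℤ → ℤ) → (ℤ → ℤ) → (E3 ≃ₗᵢ[ℝ] E3) → (E3 ≃ₗᵢ[ℝ] E3) → Prop} {C_R1 : ℝ} (hR1 : LayerRowsMachine Apart C_R1) :
    ∃ C : ℝ, BilayerWallResidualFaultedCoreOnAt
      (fun σ₁ σ₂ L₁ L₂ => X σ₁ σ₂ L₁ L₂ ∧ ⟪L₁ e₃, e₃⟫_ℝ ^ 2 < 1 / 20 ∧ Apart σ₁ σ₂ L₁ L₂) (13 / 25) C 10 := by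
  obtain ⟨C, hC⟩ := residualFaultedCoreOnAt_of_layerRowsMachine hR1
  exact ⟨C, residualFaultedCoreOnAt_anti (fun _ _ _ _ hx => hx.2) hC⟩

/-- **Zone R, plate 2**: the same from the machine of plate 2 (rows toward `−e₃`). -/
theorem coreOn_zoneR₂_of_layerRowsMachineTop (X : (ℤ → ℤ) → (ℤ → ℤ) → (E3 ≃ₗᵢ[ℝ] E3) → (E3 ≃ₗᵢ[ℝ] E3) → Prop)
    {Apart : (ℤ → ℤ) → (ℤ → ℤ) → (E3 ≃ₗᵢ[ℝ] E3) → (E3 ≃ₗᵢ[ℝ] E3) → Prop} {C_R1 : ℝ} (hR1 : LayerRowsMachineTop Apart C_R1) :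
    ∃ C : ℝ, BilayerWallResidualFaultedCoreOnAt
      (fun σ₁ σ₂ L₁ L₂ => X σ₁ σ₂ L₁ L₂ ∧ ⟪L₂ e₃, e₃⟫_ℝ ^ 2 < 1 / 20 ∧ Apart σ₁ σ₂ L₁ L₂) (13 / 25) C 10 :=
  ⟨_, residualFaultedCoreOnAt_anti (fun _ _ _ _ hx => hx.2)
    (residualFaultedCoreOnAt_of_faultedOnAt (faultedOnAt_of_layerRowsMachineTop hR1))⟩

/-- **Zone R, both plates**: the two machines give the core on `X` restricted to «SOME plate within `arcsin √(1/20)` of edge-on and apart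
(for that plate's machine)». -/
theorem coreOn_zoneR_of_layerRowsMachines (X : (ℤ → ℤ) → (ℤ → ℤ) → (E3 ≃ₗᵢ[ℝ] E3) → (E3 ≃ₗᵢ[ℝ] E3) → Prop)
    {Apart Apart' : (ℤ → ℤ) → (ℤ → ℤ) → (E3 ≃ₗᵢ[ℝ] E3) → (E3 ≃ₗᵢ[ℝ] E3) → Prop} {C_R1 C_R1' : ℝ}
    (hR1 : LayerRowsMachine Apart C_R1) (hR1' : LayerRowsMachineTop Apart' C_R1') :
    ∃ C : ℝ, BilayerWallResidualFaultedCoreOnAt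
      (fun σ₁ σ₂ L₁ L₂ => X σ₁ σ₂ L₁ L₂ ∧
        ((⟪L₁ e₃, e₃⟫_ℝ ^ 2 < 1 / 20 ∧ Apart σ₁ σ₂ L₁ L₂) ∨ (⟪L₂ e₃, e₃⟫_ℝ ^ 2 < 1 / 20 ∧ Apart' σ₁ σ₂ L₁ L₂))) (13 / 25) C 10 := by
  obtain ⟨C₁, h₁⟩ := coreOn_zoneR₁_of_layerRowsMachine X hR1
  obtain ⟨C₂, h₂⟩ := coreOn_zoneR₂_of_layerRowsMachineTop X hR1'
  refine ⟨max C₁ C₂, residualFaultedCoreOnAt_anti (fun σ₁ σ₂ L₁ L₂ hx => ?_) (residualFaultedCoreOnAt_union (by norm_num) h₁ h₂)⟩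
  rcases hx.2 with h | h
  · exact Or.inl ⟨hx.1, h⟩
  · exact Or.inr ⟨hx.1, h⟩

/-- **The zone split of a class stub**: cores on `X ∧ Z` and on `X ∧ ¬Z` give the core on `X` (`R₀ = 10`). -/
theorem coreOn_of_zones (X Z : (ℤ → ℤ) → (ℤ → ℤ) → (E3 ≃ₗᵢ[ℝ] E3) → (E3 ≃ₗᵢ[ℝ] E3) → Prop)
    (hZ : ∃ C : ℝ, BilayerWallResidualFaultedCoreOnAt (fun σ₁ σ₂ L₁ L₂ => X σ₁ σ₂ L₁ L₂ ∧ Z σ₁ σ₂ L₁ L₂) (13 / 25) C 10)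
    (hZ' : ∃ C : ℝ, BilayerWallResidualFaultedCoreOnAt (fun σ₁ σ₂ L₁ L₂ => X σ₁ σ₂ L₁ L₂ ∧ ¬ Z σ₁ σ₂ L₁ L₂) (13 / 25) C 10) :
    ∃ C : ℝ, BilayerWallResidualFaultedCoreOnAt X (13 / 25) C 10 := by
  classical
  obtain ⟨C₁, h₁⟩ := hZ
  obtain ⟨C₂, h₂⟩ := hZ'
  refine ⟨max C₁ C₂, residualFaultedCoreOnAt_anti (fun σ₁ σ₂ L₁ L₂ hx => ?_) (residualFaultedCoreOnAt_union (by norm_num) h₁ h₂)⟩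
  by_cases hz : Z σ₁ σ₂ L₁ L₂
  · exact Or.inl ⟨hx, hz⟩
  · exact Or.inr ⟨hx, hz⟩

/-- **`stub_edgeOnSep` from the machines and a zone-Z remainder** (the bump text, cf-p1 (ccxvi)(A)(2)): the LAYER ROWS machines of both plates
plus the registered remainder «`EdgeOnAt ∧ SepAt` with NEITHER plate both near edge-on and row-apart» give the SEP stub. -/
theorem edgeOnSep_of_layerRowsMachines_of_zoneZ
    {Apart Apart' : (ℤ → ℤ) → (ℤ → ℤ) → (E3 ≃ₗᵢ[ℝ] E3) → (E3 ≃ₗᵢ[ℝ] E3) → Prop} {C_R1 C_R1' : ℝ}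
    (hR1 : LayerRowsMachine Apart C_R1) (hR1' : LayerRowsMachineTop Apart' C_R1')
    (hZ : ∃ C : ℝ, BilayerWallResidualFaultedCoreOnAt
      (fun σ₁ σ₂ L₁ L₂ => (EdgeOnAt (13 / 25) σ₁ σ₂ L₁ L₂ ∧ SepAt (13 / 25) σ₁ σ₂ L₁ L₂) ∧
        ¬ ((⟪L₁ e₃, e₃⟫_ℝ ^ 2 < 1 / 20 ∧ Apart σ₁ σ₂ L₁ L₂) ∨ (⟪L₂ e₃, e₃⟫_ℝ ^ 2 < 1 / 20 ∧ Apart' σ₁ σ₂ L₁ L₂))) (13 / 25) C 10) :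
    ∃ C : ℝ, BilayerWallResidualFaultedCoreOnAt
      (fun σ₁ σ₂ L₁ L₂ => EdgeOnAt (13 / 25) σ₁ σ₂ L₁ L₂ ∧ SepAt (13 / 25) σ₁ σ₂ L₁ L₂) (13 / 25) C 10 :=
  coreOn_of_zones (fun σ₁ σ₂ L₁ L₂ => EdgeOnAt (13 / 25) σ₁ σ₂ L₁ L₂ ∧ SepAt (13 / 25) σ₁ σ₂ L₁ L₂)
    (fun σ₁ σ₂ L₁ L₂ => (⟪L₁ e₃, e₃⟫_ℝ ^ 2 < 1 / 20 ∧ Apart σ₁ σ₂ L₁ L₂) ∨ (⟪L₂ e₃, e₃⟫_ℝ ^ 2 < 1 / 20 ∧ Apart' σ₁ σ₂ L₁ L₂))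
    (coreOn_zoneR_of_layerRowsMachines _ hR1 hR1') hZ

/-- **`stub_edgeOnRead` from the machines and a zone-Z remainder**, likewise. -/
theorem edgeOnRead_of_layerRowsMachines_of_zoneZ
    {Apart Apart' : (ℤ → ℤ) → (ℤ → ℤ) → (E3 ≃ₗᵢ[ℝ] E3) → (E3 ≃ₗᵢ[ℝ] E3) → Prop} {C_R1 C_R1' : ℝ}
    (hR1 : LayerRowsMachine Apart C_R1) (hR1' : LayerRowsMachineTop Apart' C_R1')
    (hZ : ∃ C : ℝ, BilayerWallResidualFaultedCoreOnAt
      (fun σ₁ σ₂ L₁ L₂ => (EdgeOnAt (13 / 25) σ₁ σ₂ L₁ L₂ ∧ ReadAt (13 / 25) σ₁ σ₂ L₁ L₂) ∧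
        ¬ ((⟪L₁ e₃, e₃⟫_ℝ ^ 2 < 1 / 20 ∧ Apart σ₁ σ₂ L₁ L₂) ∨ (⟪L₂ e₃, e₃⟫_ℝ ^ 2 < 1 / 20 ∧ Apart' σ₁ σ₂ L₁ L₂))) (13 / 25) C 10) :
    ∃ C : ℝ, BilayerWallResidualFaultedCoreOnAt
      (fun σ₁ σ₂ L₁ L₂ => EdgeOnAt (13 / 25) σ₁ σ₂ L₁ L₂ ∧ ReadAt (13 / 25) σ₁ σ₂ L₁ L₂) (13 / 25) C 10 :=
  coreOn_of_zones (fun σ₁ σ₂ L₁ L₂ => EdgeOnAt (13 / 25) σ₁ σ₂ L₁ L₂ ∧ ReadAt (13 / 25) σ₁ σ₂ L₁ L₂)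
    (fun σ₁ σ₂ L₁ L₂ => (⟪L₁ e₃, e₃⟫_ℝ ^ 2 < 1 / 20 ∧ Apart σ₁ σ₂ L₁ L₂) ∨ (⟪L₂ e₃, e₃⟫_ℝ ^ 2 < 1 / 20 ∧ Apart' σ₁ σ₂ L₁ L₂))
    (coreOn_zoneR_of_layerRowsMachines _ hR1 hR1') hZ

end Summit.Ventures.Crystal3D.Cruxes.TextureLiminf.TexShadow

end
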